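import Literature.MathematicalPhysics.QuantumFieldTheory.Balaban1983to89.B8BlockConstantLiftStabilityRec
import Literature.MathematicalPhysics.QuantumFieldTheory.Balaban1983to89.B8Eq191FlatStencilsRec
import Literature.MathematicalPhysics.QuantumFieldTheory.Balaban1983to89.B8Eq115GaugeFixing
import Literature.MathematicalPhysics.QuantumFieldTheory.Balaban1983to89.BlockAveragingZdCovariance
import Literature.MathematicalPhysics.QuantumFieldTheory.Balaban1983to89.B12ContourAverage253

/-!
# `Balaban1983to89.B8TwoAxialGaugesOscillationRec` — [Balaban1985RegularSpaces] (1.15)∕(1.19) («the conditions (1.19) determine uniquely an element in each orbit») READ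
# QUANTITATIVELY: the transformation `τ = g₁·g₂⁻¹` between two gauges of ONE configuration whose averaged tree transporters are within `δ₁(n)`, `δ₂(n)` of `1` at every level
# varies, over every level-`(n+1)` block under a cell, by at most `Σ_{m ≤ n} (δ₁(m) + δ₂(m) + δ₁δ₂(m))` — the POINTWISE multiscale oscillation of road (B′)'s first factor (the
# junction's `τ` between the symmetric and the radial axial gauge), record tower, centred blocks, [Balaban1987RG1] (0.4) averages

statement-level skeleton of published theorems with citation tags; proofs where landed; nothing here is a claim about the Yang–Mills mass gap

CITATION HEADER (lean-in-tree rule).  Cell `pub-ymgap` (HUMAN RULING D-0062), the N05-REC → K0-road JUNCTION (width seat `pub-ymgap-dag-n07-w3` g13).  [6] = [Balaban1985RegularSpaces]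
(1.15) p. 78, (1.19) p. 79 («The conditions (1.19) determine uniquely an element in each orbit»), (1.132) p. 99; [3] = [Balaban1985Averaging] (8) p. 18, (11) p. 19, (45) p. 24; [I] =
[Balaban1987RG1] (0.3)–(0.4), (0.6) pp. 252–253.  `--kind proof --supports stmt-QuantumFields-20541` (K0⁷; count-neutral; no definition).  REUSED BY NAME: dag-n05-e's
`BlockAveragingZdCovariance.avgIterZ_gaugeAct_units` ([3] (11) for the record's `k`-fold (0.4)), `B7AvgGaugeCovariance.uLev`, `B8Eq115GaugeFixing.axialFn_gaugeAct` ((8) along the tree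
contour), `B12ContourAverage253.norm_units_conj_sub_one_eq`, `B7Prop6Bound.mul_sub_one_norm_le`, dag-n05-d's `B8Eq119TwistedAxialRec.{UnderZ, underZ_flmZ, underZ_iff_flmZ_eq,
iterate_fl_eq_flmZ, underZ_one_block, underZ_zero_iff}`, `B8Eq191FlatStencilsRec.mem_blockSitesZ_iff_fl`, `B8BlockConstantLiftStabilityRec.{underZ_add, underZ_pow_smul}`; SERVES this
seat's `B8ExpMeanLogOscFromPointwiseRec.osc_rows_of_pointwise_under` (p753816: its hypothesis `hpt` is §3's conclusion verbatim).

WHY.  Row 9′ of the def of record reads the record averages of `lift(h̄·w_s)·u⁻¹`; along road (B′) this is `a·u₀` with `a = τ·X⁻¹`, `τ := lift(h̄·w_s)·vfix⁻¹` the transformation FROM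
the crown's radial axial gauge `vfix` ([6] (1.15), `InAxOneZ`: tree transporters of every averaged field `= 1`, so `δ₂ ≡ 0`) TO the torus carrier's symmetric-convention axial gauge
(whose single-tree transporters are `1` up to the curvature of the averaged fields, `δ₁(n)` geometric in `n` — to be supplied).  Both are gauges of the same lift `V`: by (11)
`\overline{(V^g)}ⁿ = (V̄ⁿ)^{g(Lⁿ·)}` and (8) along the tree contour, `A_k := (V^{g_k})‾ⁿ(Γ_{L·z, L·z+r}) = g_k(L^{n+1}z)·V̄ⁿ(Γ)·g_k(Lⁿ(L·z+r))⁻¹`, whence the exact identity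
`τ(L^{n+1}z)⁻¹·τ(Lⁿ(L·z+r)) = A₂ · σ·A₁⁻¹·σ⁻¹` (`σ = g₂g₁⁻¹` at the block point's centre, unitary): one level costs `δ₂ + δ₁ + δ₂δ₁`, and descending the tower telescopes.

WHAT IS PROVED (sorry-free; C⋆-algebra carrier; `g₁`, `g₂` unitary at the sites under the cell).
§1 ★★ `osc_step` — the one-level identity-and-bound above.
§2 ★★★ `osc_descent` — for `t ≤ j`, `z` under `y` at depth `j − t` and every fine `w` under `z`: `‖τ(Lᵗ·z)⁻¹·τ(w) − 1‖ ≤ Σ_{m<t} (δ₂(m) + δ₁(m) + δ₂(m)δ₁(m))`.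
§3 ★★★ `pointwise_osc_of_axial_defects` — with `δ₂(m) + δ₁(m) + δ₂δ₁(m) ≤ (ω∕2)·θ^{j−(m+1)}`, `θ ≤ 1∕2`: `‖τ(L^{i+1}·z)⁻¹·τ(w) − 1‖ ≤ ω·θ^{j−(i+1)}` — VERBATIM the hypothesis `hpt` of
   `B8ExpMeanLogOscFromPointwiseRec` for `τ := fun x => g₁ x * (g₂ x)⁻¹`; ★ `norm_inv_sub_one_eq_of_mem_unitaryUnits` (`‖A⁻¹ − 1‖ = ‖A − 1‖` for unitary `A`, to feed §1's `h₁`).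
HONEST FRAMING: count-neutral helper; exact covariance bookkeeping + a telescoping sum — nothing of [6]∕[3]∕[I] asserted or discharged; the DEFECT INPUT `δ₁` for the symmetric-convention
gauge (single tree contour vs the (0.11) contour mean, from curvature smallness) and the torus↔`ℤᵈ` transcription of `AxialGauge (symCd …)` are NOT produced here; `HThm4RecSym152PhiE(G)` ∕
`HThm4Rec*` UNDISCHARGED; N07 ∕ N05 NOT discharged; K0⁷ ∕ K1⁹ NOT closed; counts unmoved (typed 28∕28 · discharged 8∕28); one finite 𝕋⁴ programme at fixed ε — R4 closes the
conditional finite-𝕋⁴ rung `BalabanLadder.UV` only; the YM mass gap (Clay) is NOT proved by any of this; nothing continuum ∕ ℝ⁴ ∕ OS.  No `def`, no `sorry`, no `instance`, no `notation`.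
-/

set_option autoImplicit false

noncomputable section

open scoped BigOperators

namespace Literature.MathematicalPhysics.QuantumFieldTheory.Balaban1983to89.B8TwoAxialGaugesOscillationRec

open B7Prop1Explicit hiding Site
open B7Prop1Explicit renaming Site → SiteZ
open B7SectEFLinearisationRec (blockSitesZ mem_blockSitesZ)
open B8Eq119TwistedAxialRec (UnderZ underZ_zero_iff underZ_one_block underZ_flmZ underZ_iff_flmZ_eq iterate_fl_eq_flmZ flmZ)
open B8BlockConstantLiftStabilityRec (underZ_add underZ_pow_smul)
open B8Eq191FlatStencilsRec (mem_blockSitesZ_iff_fl)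
open B8Ineq130Rec (fl)
open B7Prop2Explicit (unitaryUnits mem_unitaryUnits unitaryUnits_le_U1)
open B7Prop6Bound (mul_sub_one_norm_le)
open B12ContourAverage253 (norm_units_conj_sub_one_eq)
open BlockAveragingZd (offZ avgIterZ)
open BlockAveragingZdCovariance (avgIterZ_gaugeAct_units)
open B7AvgGaugeCovariance (uLev uLev_apply)
open B8Eq115GaugeFixing (axialFn_gaugeAct)

variable {d : ℕ}

/-! ## §0  Bookkeeping -/

/-- `Lⁿ·(L·z) = L^{n+1}·z`. [folklore] -/
private theorem pow_smul_Lsmul (L n : ℕ) (z : SiteZ d) : ((L : ℤ) ^ n) • ((L : ℤ) • z) = ((L : ℤ) ^ (n + 1)) • z := by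
  rw [smul_smul, ← pow_succ]

/-- A fine site under `z` at depth `t + 1` is under one of the block points `L·z + r` of `z` at depth `t` (nested centred blocks, odd `L`).
[cite: Balaban1987RG1, (0.3) p.252 (bookkeeping)] -/
private theorem exists_block_of_underZ_succ {L : ℕ} (hL : Odd L) {t : ℕ} {z w : SiteZ d} (hw : UnderZ L (t + 1) z w) :
    ∃ r : Fin d → Fin L, UnderZ L t ((L : ℤ) • z + offZ L r) w := by
  have hx : UnderZ L t (flmZ L t w) w := underZ_flmZ hL t w
  have hfl : fl L (flmZ L t w) = z := by
    have h1 : flmZ L (t + 1) w = z := (underZ_iff_flmZ_eq hL (t + 1) z w).1 hw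
    rw [← iterate_fl_eq_flmZ hL, Function.iterate_succ_apply', iterate_fl_eq_flmZ hL] at h1
    exact h1
  obtain ⟨r, hr⟩ := mem_blockSitesZ.1 ((mem_blockSitesZ_iff_fl L hL z (flmZ L t w)).2 hfl)
  exact ⟨r, hr ▸ hx⟩

section Main

variable {𝔹 : Type*} [CStarAlgebra 𝔹] [Nontrivial 𝔹]

omit [Nontrivial 𝔹] in
/-- For a unitary `A`, `‖A⁻¹ − 1‖ = ‖A − 1‖` (`A⁻¹ = A*`). [cite: Balaban1985Averaging, (19)–(20) p.21 (bookkeeping)] -/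
theorem norm_inv_sub_one_eq_of_mem_unitaryUnits {A : 𝔹ˣ} (hA : A ∈ unitaryUnits 𝔹) : ‖((A⁻¹ : 𝔹ˣ) : 𝔹) - 1‖ = ‖(A : 𝔹) - 1‖ := by
  have hA' : (A : 𝔹) ∈ unitary 𝔹 := (mem_unitaryUnits).1 hA
  have hinv : ((A⁻¹ : 𝔹ˣ) : 𝔹) = star (A : 𝔹) := by
    have h1 : ((A⁻¹ : 𝔹ˣ) : 𝔹) * (A : 𝔹) = 1 := by rw [← Units.val_mul, inv_mul_cancel, Units.val_one]
    have h2 : star (A : 𝔹) * (A : 𝔹) = 1 := Unitary.star_mul_self_of_mem hA'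
    calc ((A⁻¹ : 𝔹ˣ) : 𝔹) = ((A⁻¹ : 𝔹ˣ) : 𝔹) * ((A : 𝔹) * star (A : 𝔹)) := by rw [Unitary.mul_star_self_of_mem hA', mul_one]
      _ = star (A : 𝔹) := by rw [← mul_assoc, h1, one_mul]
  rw [hinv, ← star_one 𝔹, ← star_sub, norm_star, star_one]

omit [Nontrivial 𝔹] in
/-- `‖X·Y − 1‖ ≤ ‖X − 1‖ + ‖Y − 1‖` when `‖X‖ ≤ 1`. [folklore] -/
private theorem norm_mul_sub_one_le_add {X Y : 𝔹} (hX : ‖X‖ ≤ 1) : ‖X * Y - 1‖ ≤ ‖X - 1‖ + ‖Y - 1‖ := by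
  have h : X * Y - 1 = X * (Y - 1) + (X - 1) := by noncomm_ring
  rw [h]
  calc ‖X * (Y - 1) + (X - 1)‖ ≤ ‖X * (Y - 1)‖ + ‖X - 1‖ := norm_add_le _ _
    _ ≤ ‖X‖ * ‖Y - 1‖ + ‖X - 1‖ := by gcongr; exact norm_mul_le _ _
    _ ≤ 1 * ‖Y - 1‖ + ‖X - 1‖ := by gcongr
    _ = ‖X - 1‖ + ‖Y - 1‖ := by ring

/-! ## §1  One level: the exact identity and its bound -/

/-- ★★ **ONE LEVEL OF THE DESCENT** ([3] (11) for the record's (0.4) average + (8) along the tree contour): for a configuration `V` on `ℤᵈ`, gauge functions `g₁`, `g₂` unitary at the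
centre `c_r = Lⁿ·(L·z + r)` of the block point, and the averaged tree transporters `A_k := (V^{g_k})‾ⁿ(Γ_{L·z, L·z+r})` with `‖A₁⁻¹ − 1‖ ≤ δ₁`, `‖A₂ − 1‖ ≤ δ₂`: the transformation
`τ = g₁·g₂⁻¹` satisfies `‖τ(L^{n+1}·z)⁻¹·τ(Lⁿ·(L·z + r)) − 1‖ ≤ δ₂ + δ₁ + δ₂·δ₁` (exactly: `τ(c)⁻¹τ(c_r) = A₂·σA₁⁻¹σ⁻¹`, `σ = g₂(c_r)g₁(c_r)⁻¹`).
[cite: Balaban1985Averaging, (8) p.18, (11) p.19, (45) p.24; Balaban1985RegularSpaces, (1.19) p.79; Balaban1987RG1, (0.4) p.253, (0.6) p.253] -/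
theorem osc_step {L : ℕ} (V : SiteZ d → Fin d → 𝔹ˣ) (g₁ g₂ : SiteZ d → 𝔹ˣ) (n : ℕ) (z : SiteZ d) (r : Fin d → Fin L)
    (hg₁ : g₁ (((L : ℤ) ^ n) • ((L : ℤ) • z + offZ L r)) ∈ unitaryUnits 𝔹) (hg₂ : g₂ (((L : ℤ) ^ n) • ((L : ℤ) • z + offZ L r)) ∈ unitaryUnits 𝔹) {δ₁ δ₂ : ℝ}
    (h₁ : ‖(((axialFn (avgIterZ L (gaugeAct g₁ V) n) ((L : ℤ) • z) ((L : ℤ) • z + offZ L r))⁻¹ : 𝔹ˣ) : 𝔹) - 1‖ ≤ δ₁)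
    (h₂ : ‖((axialFn (avgIterZ L (gaugeAct g₂ V) n) ((L : ℤ) • z) ((L : ℤ) • z + offZ L r) : 𝔹ˣ) : 𝔹) - 1‖ ≤ δ₂) :
    ‖((((g₁ (((L : ℤ) ^ (n + 1)) • z) * (g₂ (((L : ℤ) ^ (n + 1)) • z))⁻¹)⁻¹ *
        (g₁ (((L : ℤ) ^ n) • ((L : ℤ) • z + offZ L r)) * (g₂ (((L : ℤ) ^ n) • ((L : ℤ) • z + offZ L r)))⁻¹) : 𝔹ˣ)) : 𝔹) - 1‖ ≤ δ₂ + δ₁ + δ₂ * δ₁ := by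
  set c : SiteZ d := ((L : ℤ) ^ (n + 1)) • z with hc
  set cr : SiteZ d := ((L : ℤ) ^ n) • ((L : ℤ) • z + offZ L r) with hcr
  set T : 𝔹ˣ := axialFn (avgIterZ L V n) ((L : ℤ) • z) ((L : ℤ) • z + offZ L r) with hT
  set A₁ : 𝔹ˣ := axialFn (avgIterZ L (gaugeAct g₁ V) n) ((L : ℤ) • z) ((L : ℤ) • z + offZ L r) with hA₁
  set A₂ : 𝔹ˣ := axialFn (avgIterZ L (gaugeAct g₂ V) n) ((L : ℤ) • z) ((L : ℤ) • z + offZ L r) with hA₂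
  -- (11) + (8): `A_k = g_k(c) · T · g_k(c_r)⁻¹`
  have hAk : ∀ g : SiteZ d → 𝔹ˣ, axialFn (avgIterZ L (gaugeAct g V) n) ((L : ℤ) • z) ((L : ℤ) • z + offZ L r) = g c * T * (g cr)⁻¹ := by
    intro g
    rw [avgIterZ_gaugeAct_units L g V n, axialFn_gaugeAct, uLev_apply, uLev_apply, pow_smul_Lsmul]
  have hA₁' : A₁ = g₁ c * T * (g₁ cr)⁻¹ := hAk g₁
  have hA₂' : A₂ = g₂ c * T * (g₂ cr)⁻¹ := hAk g₂
  -- the exact identity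
  have key : (g₁ c * (g₂ c)⁻¹)⁻¹ * (g₁ cr * (g₂ cr)⁻¹) = A₂ * ((g₂ cr * (g₁ cr)⁻¹) * A₁⁻¹ * (g₂ cr * (g₁ cr)⁻¹)⁻¹) := by
    rw [hA₁', hA₂']; group
  have hσ : g₂ cr * (g₁ cr)⁻¹ ∈ U1 𝔹 := unitaryUnits_le_U1 ((unitaryUnits 𝔹).mul_mem hg₂ ((unitaryUnits 𝔹).inv_mem hg₁))
  have hconj : ‖((((g₂ cr * (g₁ cr)⁻¹) * A₁⁻¹ * (g₂ cr * (g₁ cr)⁻¹)⁻¹ : 𝔹ˣ)) : 𝔹) - 1‖ ≤ δ₁ := by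
    rw [Units.val_mul, Units.val_mul, norm_units_conj_sub_one_eq hσ]
    exact h₁
  have hδ₁ : 0 ≤ δ₁ := (norm_nonneg _).trans h₁
  have hδ₂ : 0 ≤ δ₂ := (norm_nonneg _).trans h₂
  rw [key, Units.val_mul]
  refine (mul_sub_one_norm_le _ _).trans ?_
  calc (1 + ‖(A₂ : 𝔹) - 1‖) * (1 + ‖((((g₂ cr * (g₁ cr)⁻¹) * A₁⁻¹ * (g₂ cr * (g₁ cr)⁻¹)⁻¹ : 𝔹ˣ)) : 𝔹) - 1‖) - 1
      ≤ (1 + δ₂) * (1 + δ₁) - 1 := by gcongr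
    _ = δ₂ + δ₁ + δ₂ * δ₁ := by ring

/-! ## §2  Descending the tower: the telescoping sum -/

/-- ★★★ **THE POINTWISE MULTISCALE OSCILLATION OF `τ = g₁·g₂⁻¹` UNDER A CELL FROM THE AVERAGED TREE-TRANSPORTER DEFECTS OF THE TWO GAUGES** ([6] (1.15)∕(1.19) read quantitatively,
record tower): fix a cell `y` of level `j`; assume `g₁`, `g₂` unitary at every fine site under `y`, and for every `n < j`, every level-`(n+1)` point `z` under `y` and every block point:
`‖A₁(n,z,r)⁻¹ − 1‖ ≤ δ₁(n)`, `‖A₂(n,z,r) − 1‖ ≤ δ₂(n)` (`A_k` the tree transporter of `(V^{g_k})‾ⁿ` from `L·z` to `L·z + r`).  Then for `t ≤ j`, `z` under `y` at depth `j − t` and every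
fine `w` under `z`: `‖τ(Lᵗ·z)⁻¹·τ(w) − 1‖ ≤ Σ_{m<t} (δ₂(m) + δ₁(m) + δ₂(m)δ₁(m))`.
[cite: Balaban1985RegularSpaces, (1.15) p.78, (1.19) p.79, (1.132) p.99; Balaban1985Averaging, (8) p.18, (11) p.19; Balaban1987RG1, (0.3)–(0.4) pp.252–253] -/
theorem osc_descent {L : ℕ} (hL : Odd L) (V : SiteZ d → Fin d → 𝔹ˣ) (g₁ g₂ : SiteZ d → 𝔹ˣ) (j : ℕ) (y : SiteZ d)
    (hg₁ : ∀ x, UnderZ L j y x → g₁ x ∈ unitaryUnits 𝔹) (hg₂ : ∀ x, UnderZ L j y x → g₂ x ∈ unitaryUnits 𝔹) (δ₁ δ₂ : ℕ → ℝ)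
    (h₁ : ∀ n, n < j → ∀ z, UnderZ L (j - (n + 1)) y z → ∀ r : Fin d → Fin L,
      ‖(((axialFn (avgIterZ L (gaugeAct g₁ V) n) ((L : ℤ) • z) ((L : ℤ) • z + offZ L r))⁻¹ : 𝔹ˣ) : 𝔹) - 1‖ ≤ δ₁ n)
    (h₂ : ∀ n, n < j → ∀ z, UnderZ L (j - (n + 1)) y z → ∀ r : Fin d → Fin L,
      ‖((axialFn (avgIterZ L (gaugeAct g₂ V) n) ((L : ℤ) • z) ((L : ℤ) • z + offZ L r) : 𝔹ˣ) : 𝔹) - 1‖ ≤ δ₂ n) :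
    ∀ t, t ≤ j → ∀ z, UnderZ L (j - t) y z → ∀ w, UnderZ L t z w →
      ‖((((g₁ (((L : ℤ) ^ t) • z) * (g₂ (((L : ℤ) ^ t) • z))⁻¹)⁻¹ * (g₁ w * (g₂ w)⁻¹) : 𝔹ˣ)) : 𝔹) - 1‖ ≤
        ∑ m ∈ Finset.range t, (δ₂ m + δ₁ m + δ₂ m * δ₁ m) := by
  -- `τ` is unitary under `y`
  have hτ : ∀ x, UnderZ L j y x → g₁ x * (g₂ x)⁻¹ ∈ unitaryUnits 𝔹 := fun x hx => (unitaryUnits 𝔹).mul_mem (hg₁ x hx) ((unitaryUnits 𝔹).inv_mem (hg₂ x hx))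
  intro t
  induction t with
  | zero =>
    intro _ z _ w hw
    rw [(underZ_zero_iff L z w).1 hw, pow_zero, one_smul, inv_mul_cancel, Units.val_one, sub_self, norm_zero, Finset.range_zero, Finset.sum_empty]
  | succ t ih =>
    intro ht z hz w hw
    have htj : t < j := by omega
    have hdepth : j - (t + 1) + 1 = j - t := by omega
    obtain ⟨r, hr⟩ := exists_block_of_underZ_succ hL hw
    -- the block point `x_r` is under `y` at depth `j − t`, its fine centre `c_r` under `y` at depth `j`, and so is `c = L^{t+1}·z`
    have hxr : UnderZ L (j - t) y ((L : ℤ) • z + offZ L r) := by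
      obtain ⟨s, hs⟩ := hL
      have h := underZ_add ⟨s, hs⟩ hz (underZ_one_block (by omega : L = 2 * s + 1) z r); rwa [hdepth] at h
    have hcr : UnderZ L j y (((L : ℤ) ^ t) • ((L : ℤ) • z + offZ L r)) := by
      have h := underZ_add hL hxr (underZ_pow_smul L t ((L : ℤ) • z + offZ L r))
      have e : j - t + t = j := by omega
      rwa [e] at h
    have hc : UnderZ L j y (((L : ℤ) ^ (t + 1)) • z) := by
      have h := underZ_add hL hz (underZ_pow_smul L (t + 1) z)
      have e : j - (t + 1) + (t + 1) = j := by omega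
      rwa [e] at h
    -- one level + the induction hypothesis at the block point
    have hstep := osc_step V g₁ g₂ t z r (hg₁ _ hcr) (hg₂ _ hcr) (h₁ t htj z hz r) (h₂ t htj z hz r)
    have hih := ih htj.le _ hxr w hr
    have hU : ((g₁ (((L : ℤ) ^ (t + 1)) • z) * (g₂ (((L : ℤ) ^ (t + 1)) • z))⁻¹)⁻¹ *
        (g₁ (((L : ℤ) ^ t) • ((L : ℤ) • z + offZ L r)) * (g₂ (((L : ℤ) ^ t) • ((L : ℤ) • z + offZ L r)))⁻¹)) ∈ unitaryUnits 𝔹 :=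
      (unitaryUnits 𝔹).mul_mem ((unitaryUnits 𝔹).inv_mem (hτ _ hc)) (hτ _ hcr)
    have hsplit : ((g₁ (((L : ℤ) ^ (t + 1)) • z) * (g₂ (((L : ℤ) ^ (t + 1)) • z))⁻¹)⁻¹ * (g₁ w * (g₂ w)⁻¹)) =
        (((g₁ (((L : ℤ) ^ (t + 1)) • z) * (g₂ (((L : ℤ) ^ (t + 1)) • z))⁻¹)⁻¹ *
          (g₁ (((L : ℤ) ^ t) • ((L : ℤ) • z + offZ L r)) * (g₂ (((L : ℤ) ^ t) • ((L : ℤ) • z + offZ L r)))⁻¹)) *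
          ((g₁ (((L : ℤ) ^ t) • ((L : ℤ) • z + offZ L r)) * (g₂ (((L : ℤ) ^ t) • ((L : ℤ) • z + offZ L r)))⁻¹)⁻¹ * (g₁ w * (g₂ w)⁻¹))) := by
      group
    rw [hsplit, Units.val_mul, Finset.sum_range_succ]
    refine (norm_mul_sub_one_le_add (unitaryUnits_le_U1 hU).1).trans ?_
    linarith [hstep, hih]

/-! ## §3  Geometric defects give the pointwise hypothesis of `B8ExpMeanLogOscFromPointwiseRec` -/

/-- A geometric tail: `Σ_{m<t} θ^{j−(m+1)} ≤ 2·θ^{j−t}` for `t ≤ j`, `0 ≤ θ ≤ 1∕2`. [folklore] -/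
private theorem sum_geom_tail_le {θ : ℝ} (hθ0 : 0 ≤ θ) (hθ : θ ≤ 1 / 2) (j : ℕ) :
    ∀ t, t ≤ j → ∑ m ∈ Finset.range t, θ ^ (j - (m + 1)) ≤ 2 * θ ^ (j - t)
  | 0, _ => by rw [Finset.range_zero, Finset.sum_empty]; positivity
  | t + 1, ht => by
    have h := sum_geom_tail_le hθ0 hθ j t (Nat.le_of_succ_le ht)
    have hpow : θ ^ (j - t) = θ * θ ^ (j - (t + 1)) := by
      rw [← pow_succ', show j - (t + 1) + 1 = j - t by omega]
    rw [Finset.sum_range_succ]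
    have h0 : 0 ≤ θ ^ (j - (t + 1)) := pow_nonneg hθ0 _
    nlinarith

/-- ★★★ **THE POINTWISE HYPOTHESIS `hpt` OF `B8ExpMeanLogOscFromPointwiseRec` FOR `τ := fun x => g₁ x * (g₂ x)⁻¹`, FROM GEOMETRIC DEFECTS**: if, under the cell, the one-level costs satisfy
`δ₂(m) + δ₁(m) + δ₂(m)δ₁(m) ≤ (ω∕2)·θ^{j−(m+1)}` for `m < j` with `0 ≤ θ ≤ 1∕2`, then for every `i < j`, every level-`(i+1)` point `z` under `y` (depth `j − (i+1)`) and every fine `w` under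
`z`: `‖τ(L^{i+1}·z)⁻¹·τ(w) − 1‖ ≤ ω·θ^{j−(i+1)}`. [cite: Balaban1985RegularSpaces, (1.15) p.78, (1.19) p.79; Balaban1985Averaging, (11) p.19; Balaban1987RG1, (0.4) p.253] -/
theorem pointwise_osc_of_axial_defects {L : ℕ} (hL : Odd L) (V : SiteZ d → Fin d → 𝔹ˣ) (g₁ g₂ : SiteZ d → 𝔹ˣ) (j : ℕ) (y : SiteZ d)
    (hg₁ : ∀ x, UnderZ L j y x → g₁ x ∈ unitaryUnits 𝔹) (hg₂ : ∀ x, UnderZ L j y x → g₂ x ∈ unitaryUnits 𝔹) (δ₁ δ₂ : ℕ → ℝ) {ω θ : ℝ}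
    (hθ0 : 0 ≤ θ) (hθ : θ ≤ 1 / 2) (hω0 : 0 ≤ ω)
    (h₁ : ∀ n, n < j → ∀ z, UnderZ L (j - (n + 1)) y z → ∀ r : Fin d → Fin L,
      ‖(((axialFn (avgIterZ L (gaugeAct g₁ V) n) ((L : ℤ) • z) ((L : ℤ) • z + offZ L r))⁻¹ : 𝔹ˣ) : 𝔹) - 1‖ ≤ δ₁ n)
    (h₂ : ∀ n, n < j → ∀ z, UnderZ L (j - (n + 1)) y z → ∀ r : Fin d → Fin L,
      ‖((axialFn (avgIterZ L (gaugeAct g₂ V) n) ((L : ℤ) • z) ((L : ℤ) • z + offZ L r) : 𝔹ˣ) : 𝔹) - 1‖ ≤ δ₂ n)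
    (hE : ∀ m, m < j → δ₂ m + δ₁ m + δ₂ m * δ₁ m ≤ ω / 2 * θ ^ (j - (m + 1))) :
    ∀ i, i < j → ∀ z, UnderZ L (j - (i + 1)) y z → ∀ w, UnderZ L (i + 1) z w →
      ‖(((((fun x => g₁ x * (g₂ x)⁻¹) (((L : ℤ) ^ (i + 1)) • z))⁻¹ * (fun x => g₁ x * (g₂ x)⁻¹) w : 𝔹ˣ)) : 𝔹) - 1‖ ≤ ω * θ ^ (j - (i + 1)) := by
  intro i hij z hz w hw
  have h := osc_descent hL V g₁ g₂ j y hg₁ hg₂ δ₁ δ₂ h₁ h₂ (i + 1) hij z hz w hw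
  refine h.trans ?_
  calc ∑ m ∈ Finset.range (i + 1), (δ₂ m + δ₁ m + δ₂ m * δ₁ m)
      ≤ ∑ m ∈ Finset.range (i + 1), ω / 2 * θ ^ (j - (m + 1)) :=
        Finset.sum_le_sum fun m hm => hE m (lt_of_lt_of_le (Finset.mem_range.1 hm) hij)
    _ = ω / 2 * ∑ m ∈ Finset.range (i + 1), θ ^ (j - (m + 1)) := by rw [Finset.mul_sum]
    _ ≤ ω / 2 * (2 * θ ^ (j - (i + 1))) := mul_le_mul_of_nonneg_left (sum_geom_tail_le hθ0 hθ j (i + 1) hij) (by positivity)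
    _ = ω * θ ^ (j - (i + 1)) := by ring

end Main

end Literature.MathematicalPhysics.QuantumFieldTheory.Balaban1983to89.B8TwoAxialGaugesOscillationRec

end
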